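import Summits.BirchSwinnertonDyer.BirchSwinnertonDyer.Theorems.GenusKolyvaginAtTwoPowDvdShaCardAtTwoRTCrossPairProvenanceSocket
import Summits.BirchSwinnertonDyer.BirchSwinnertonDyer.Theorems.GenusKolyvaginAtTwoPubInputsAtTwoDefs
import Summits.BirchSwinnertonDyer.BirchSwinnertonDyer.Theorems.GenusKolyvaginAtTwoCasselsTateTotallyComplex
import Summits.BirchSwinnertonDyer.BirchSwinnertonDyer.Theorems.Rank1ResidualJetWeilDatumConj
import Literature.NumberTheory.GaloisCohomology.LocalInvariantMapConjCompatible
import Literature.NumberTheory.GaloisCohomology.PoitouTateNumberField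
import Literature.NumberTheory.EllipticCurves.CasselsTateFiniteSupport
import HarnessLib

/-!
# Route `GenusKolyvaginAtTwo`, LINE 18 v6 «E4» (L_T `PowDvdShaCardAtTwoRT`, stmt-BirchSwinnertonDyer-23659) — X-ORTH∃ WITHOUT THE IDLE `PubInputsAtTwo`
# ANTECEDENT (for the P-free skeleton v6.2: L_T ⟸ {X-ORTH∃ ✓, `rank E(K) ≤ 1`})

Seat `bsd-line-gk2-p2` g20 (PROVER seat 2/3, cell `bsd-f1-sign2`), `--supports` L_T (helper; closes nothing).  THEOREMS ONLY; BSD is not proved by any of this.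

WHY.  The registered X-ORTH∃ text of v6 (my draft, frozen 19:16Z; gk2-p5 g27's theorem `stub_ctOrthogonalAtTwo`, p740728) carries the skeleton's conventional
prefix `PubInputsAtTwo →`, which gk2-p5's proof never uses (`intro _hP …`).  gk2-p4 g21's P-reduction (p741898) displays `rank E(K) ≤ 1` instead of the
published inputs; for the composition to be P-free the X-ORTH∃ input must not ask for `PubInputsAtTwo` either.  **`ctOrthogonalAtTwo_noPubInputs`** = gk2-p5's
theorem with that antecedent REMOVED — proof VERBATIM (credit: gk2-p5 g27 p740728 over gk2-p4 g20 p737900/p738908/p739464 and p739559/p740274; `B` := the canonical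
Cassels–Tate level pairing at `2^k` of the lift-equivariant Weil datum, level clause from `isLevelPairing_ctLevelPairing_canonical`, orthogonality from
`ctLevelPairing_hOrth_of_kolyvagin_provenance`).

References: [McCallumLMS1991] §4 Prop. 4.7, §5 Lemma 5.3, Thm. 5.4; [MilneADT2006] Ch. I §6 Prop. 6.9, Lemma 6.17; [Cassels1962ArithmeticIV] §1; [GrossLMS1991] Prop. 5.4, Prop. 6.2.
-/

set_option autoImplicit false
-- the Theorems namespace of this sub repeats the summit name by design (D-0017 nested layout)
set_option linter.dupNamespace false

noncomputable section

open scoped Classical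
open scoped AddSubgroup
open Function Field NumberField IsDedekindDomain WeierstrassCurve
open Literature.NumberTheory.EllipticCurves Literature.NumberTheory.GaloisRepresentations
open Literature.NumberTheory.EllipticCurves.ModularForms
open Literature.NumberTheory.GaloisCohomology
open Summit.BirchSwinnertonDyer.Rank1Residual.JET.GlobalDuality
open Summit.BirchSwinnertonDyer.BirchSwinnertonDyer.Theses.GenusKolyvaginAtTwo

-- the Theorems namespace of this sub repeats the summit name by design (D-0017 nested layout)
set_option linter.dupNamespace false

namespace Summit.BirchSwinnertonDyer.BirchSwinnertonDyer.Theorems.GenusExact.PlusDescent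

/-- **X-ORTH∃ of LINE 18 v6 «E4» WITHOUT the idle `PubInputsAtTwo` antecedent** (otherwise byte-identical to the registered text / gk2-p5's
`stub_ctOrthogonalAtTwo`): on L_T's frame, for every non-trivial `τ ∈ Aut(K/ℚ)` and every `k ≥ M₀ + 6`, the level-`2^k` Cassels–Tate pairing of the canonical
invariant maps on `Ш(E_K)[2^k]` (lift-equivariant Weil datum) satisfies the level clause and kills «(+)-provenance × (−)-provenance» at class level `2^(2k)`.
Proof = gk2-p5 g27's, verbatim. [cite: McCallumLMS1991, §4 Prop. 4.7, §5 Lemma 5.3, Thm. 5.4] [cite: MilneADT2006, Ch. I §6 Prop. 6.9, Lemma 6.17]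
[cite: Cassels1962ArithmeticIV, §1] [cite: GrossLMS1991, Prop. 5.4, Prop. 6.2] -/
theorem ctOrthogonalAtTwo_noPubInputs :
    KolyvaginRelationAtTwo → EquivariantChebotarevAtTwoR → ∀ (W : WeierstrassCurve ℚ) [W.IsElliptic] [W.IsGloballyMinimal] [NeZero (W.conductorNorm ℤ)], ¬ W.HasCM → Odd W.tamagawaProduct → ∀ (v : IsDedekindDomain.HeightOneSpectrum (NumberField.RingOfIntegers ℚ)), ((2 : ℕ) : NumberField.RingOfIntegers ℚ) ∉ v.asIdeal → ((W.conductorNorm ℤ : ℕ) : NumberField.RingOfIntegers ℚ) ∈ v.asIdeal → W.HasMultiplicativeReductionAt v → W.Δ < 0 → ∀ (K : Type) [Field K] [NumberField K], Literature.NumberTheory.EllipticCurves.IsImaginaryQuadratic K → Odd (NumberField.discr K) → NumberField.discr K ≠ -3 → Literature.NumberTheory.EllipticCurves.SatisfiesHeegnerHypothesis (W.conductorNorm ℤ) K → ¬ IsSquare ((NumberField.discr K : ℚ) * -|W.Δ|) → ¬ IsSquare ((NumberField.discr K : ℚ) * (-(2 * |W.Δ|))) → (∀ n : ℕ, 0 <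 n → W.HasSurjectiveModNGaloisRep ((2 : ℤ) ^ n)) → ∀ (Dt : Literature.NumberTheory.EllipticCurves.ModularForms.ModularParametrizationData W (W.conductorNorm ℤ)) (β : ℤ) (ι : K →+* ℂ) (d₁ : Literature.NumberTheory.EllipticCurves.KolyvaginHeegnerData Dt β ι 1), ¬ IsOfFinAddOrder d₁.derivedPoint → ∀ (M₀ : ℕ), (∃ Q : (W.baseChange (Literature.NumberTheory.EllipticCurves.ringClassField K ι 1)).toAffine.Point, ((2 ^ M₀ : ℕ) : ℤ) • Q = d₁.derivedPoint) → (¬ ∃ Q : (W.baseChange (Literature.NumberTheory.EllipticCurves.ringClassField K ι 1)).toAffine.Point, ((2 ^ (M₀ + 1) : ℕ) : ℤ) • Q = d₁.derivedPoint) → ∀ τ : K ≃ₐ[ℚ] K, τ ≠ 1 → ∀ k : ℕ, M₀ + 6 ≤ k →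
      ∃ B : ↥((↥(W.baseChange K).sha)[((2 ^ k : ℕ) : ℤ)]) →+ ↥((↥(W.baseChange K).sha)[((2 ^ k : ℕ) : ℤ)]) →+ AddCircle (1 : ℚ),
      (∀ x : ↥((↥(W.baseChange K).sha)[((2 ^ k : ℕ) : ℤ)]), B x = 0 →
        ∃ z : (W.baseChange K).sha, (2 ^ k) • z = (x : (W.baseChange K).sha)) ∧
      (∀ x x' : ↥((↥(W.baseChange K).sha)[((2 ^ k : ℕ) : ℤ)]),
      (∃ (n : ℕ) (d : KolyvaginHeegnerData Dt β ι n) (e : ℕ), Squarefree n ∧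
        (∀ ℓ ∈ n.primeFactors, Zhang2014.IsKolyvaginPrime (W.conductorNorm ℤ) W K 2 ℓ ∧ 2 * k ≤ Zhang2014.kolyvaginIndex W 2 ℓ ∧
          FrobEqFrobInfty W K (2 ^ (2 * k)) ℓ) ∧
        e ≤ k ∧
        ((2 ^ (2 * k - e) : ℕ) : ℤ) • d.kolyvaginClass Nat.prime_two (2 * k) ∈ selmerGroup (W.baseChange K) ((2 ^ (2 * k) : ℕ) : ℤ) ∧
        (∀ ℓ ∈ n.primeFactors, ∀ u : HeightOneSpectrum (𝓞 K), ((ℓ : ℕ) : 𝓞 K) ∈ u.asIdeal →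
          ((2 ^ (2 * k - e) : ℕ) : ℤ) • d.kolyvaginClass Nat.prime_two (2 * k) ∈
            (W.baseChange K).torsionLocalKer (u.adicCompletion K) ((2 ^ (2 * k) : ℕ) : ℤ)) ∧
        conjAct W τ ((2 ^ (2 * k) : ℕ) : ℤ) (((2 ^ (2 * k - e) : ℕ) : ℤ) • d.kolyvaginClass Nat.prime_two (2 * k)) =
          W.rootNumber • (((2 ^ (2 * k - e) : ℕ) : ℤ) • d.kolyvaginClass Nat.prime_two (2 * k)) ∧
        ((x : (W.baseChange K).sha) : (W.baseChange K).galH1) =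
          torsionH1ToH1 (W.baseChange K) ((2 ^ (2 * k) : ℕ) : ℤ) (((2 ^ (2 * k - e) : ℕ) : ℤ) • d.kolyvaginClass Nat.prime_two (2 * k))) →
      (∃ (n : ℕ) (d : KolyvaginHeegnerData Dt β ι n) (e : ℕ), Squarefree n ∧
        (∀ ℓ ∈ n.primeFactors, Zhang2014.IsKolyvaginPrime (W.conductorNorm ℤ) W K 2 ℓ ∧ 2 * k ≤ Zhang2014.kolyvaginIndex W 2 ℓ ∧
          FrobEqFrobInfty W K (2 ^ (2 * k)) ℓ) ∧
        e ≤ k ∧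
        ((2 ^ (2 * k - e) : ℕ) : ℤ) • d.kolyvaginClass Nat.prime_two (2 * k) ∈ selmerGroup (W.baseChange K) ((2 ^ (2 * k) : ℕ) : ℤ) ∧
        (∀ ℓ ∈ n.primeFactors, ∀ u : HeightOneSpectrum (𝓞 K), ((ℓ : ℕ) : 𝓞 K) ∈ u.asIdeal →
          ((2 ^ (2 * k - e) : ℕ) : ℤ) • d.kolyvaginClass Nat.prime_two (2 * k) ∈
            (W.baseChange K).torsionLocalKer (u.adicCompletion K) ((2 ^ (2 * k) : ℕ) : ℤ)) ∧
        conjAct W τ ((2 ^ (2 * k) : ℕ) : ℤ) (((2 ^ (2 * k - e) : ℕ) : ℤ) • d.kolyvaginClass Nat.prime_two (2 * k)) =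
          (-W.rootNumber) • (((2 ^ (2 * k - e) : ℕ) : ℤ) • d.kolyvaginClass Nat.prime_two (2 * k)) ∧
        ((x' : (W.baseChange K).sha) : (W.baseChange K).galH1) =
          torsionH1ToH1 (W.baseChange K) ((2 ^ (2 * k) : ℕ) : ℤ) (((2 ^ (2 * k - e) : ℕ) : ℤ) • d.kolyvaginClass Nat.prime_two (2 * k))) →
      B x x' = 0) := by
  intro _hQ2 _hQ5R W _ _ _ _hcm hT _v _h2v _hNv _hmult hneg K _ _ hIQ hodd h3 hHe _hsq1 _hsq2 hρ Dt β ι _d₁ _hy M₀ _hdiv _hndiv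
    τ hτ k hk
  haveI : Fact (Nat.Prime 2) := ⟨Nat.prime_two⟩
  haveI : IsTotallyComplex K := hIQ.2
  haveI hell : (W.baseChange K).IsElliptic := inferInstanceAs ((W.map (algebraMap ℚ K)).IsElliptic)
  haveI : NeZero (2 ^ k) := ⟨pow_ne_zero _ two_ne_zero⟩
  haveI : NeZero (2 ^ k * 2 ^ k) := ⟨mul_ne_zero (pow_ne_zero _ two_ne_zero) (pow_ne_zero _ two_ne_zero)⟩
  have hk1 : 1 ≤ k := by omega
  have hρ2 : W.HasSurjectiveModNGaloisRep 2 := by simpa using hρ 1 one_pos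
  have h2N : 2 ≤ 2 ^ k * 2 ^ k := by
    have h1 : 1 ≤ 2 ^ k := Nat.one_le_two_pow
    have h2 : 2 ≤ 2 ^ k := by
      calc (2 : ℕ) = 2 ^ 1 := by norm_num
        _ ≤ 2 ^ k := Nat.pow_le_pow_right (by norm_num) hk1
    nlinarith
  -- the Weil datum, equivariant under every lift of every `σ ∈ Aut(K/ℚ)`
  obtain ⟨e, hμ, hadd₁, hadd₂, halt, hnd, hgal, hlift⟩ := exists_weilPairing_liftEquivariant W K (2 ^ k * 2 ^ k) h2N
  -- the canonical invariant maps and the level pairing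
  have hB := CasselsTateTotallyComplex.isLevelPairing_ctLevelPairing_canonical (W.baseChange K) 2 k e hμ hadd₁ hadd₂ hgal halt hnd hk1
  refine ⟨ctLevelPairing (W.baseChange K) (2 ^ k) e hμ hadd₁ hadd₂ hgal (LocalInvariants.canonical K (2 ^ k * 2 ^ k)) halt
      (sumInvLocalizationEqZero_canonical_of_numberField K (2 ^ k * 2 ^ k))
      (CasselsTatePTc.shaThree_mu_eq_zero_of_isTotallyComplex (K := K) (2 ^ k * 2 ^ k))
      (localTerm_finite_support (W.baseChange K) (2 ^ k) e hμ hadd₁ hadd₂ hgal halt (LocalInvariants.canonical K (2 ^ k * 2 ^ k))),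
    fun x hx ↦ (hB.2 x).mp fun y ↦ ?_, ?_⟩
  · rw [hx, AddMonoidHom.zero_apply]
  · exact ctLevelPairing_hOrth_of_kolyvagin_provenance W K hIQ hneg hodd h3 hHe hT hρ2 τ hτ Dt β ι (2 * k) k rfl hk1 e hμ hadd₁ hadd₂
      hgal halt hlift (LocalInvariants.canonical K (2 ^ k * 2 ^ k)) (isConjCompatible_canonical τ (2 ^ k * 2 ^ k))
      (sumInvLocalizationEqZero_canonical_of_numberField K (2 ^ k * 2 ^ k))
      (CasselsTatePTc.shaThree_mu_eq_zero_of_isTotallyComplex (K := K) (2 ^ k * 2 ^ k))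
      (localTerm_finite_support (W.baseChange K) (2 ^ k) e hμ hadd₁ hadd₂ hgal halt (LocalInvariants.canonical K (2 ^ k * 2 ^ k)))

end Summit.BirchSwinnertonDyer.BirchSwinnertonDyer.Theorems.GenusExact.PlusDescent

end
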